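import Literature.AnabelianGeometry.SemiGraphs.TemperedCoverings
import Literature.AnabelianGeometry.SemiGraphs.TreeSystemFixedPointTopological

/-!
# [SemiAnbd] Theorem 3.7 (iii), first part — case (a) of the author's replacement proof, at tree
# level, modulo the level data of the chart

Mochizuki, *Semi-graphs of Anabelioids*, Publ. RIMS **42** (2006) 221–322, Theorem 3.7 (iii)
(p. 41) [cite: MochizukiSemiAnbd2006, Thm. 3.7(iii) p.41], in the form of the author's *Comments*
(May 2020), item (6): "let us write `V_i`, `E_i` for the sets of vertices and closed edges,
respectively, of `𝒢_{i,∞}` that are fixed by the action of `H` … we have `#V_i ≥ 1` …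
(a) Suppose that for some cofinal subset `J ⊆ I`, we have `#V_j = 1`, for all `j ∈ J`.  Then the
unique elements of the `V_j`, for `j ∈ J`, form a compatible system of vertices fixed by `H`.
Thus, we conclude that `H` is contained in some verticial subgroup of `π₁^temp(𝒢)`.
(b) Suppose that for some cofinal subset `J ⊆ I`, we have `#V_j ≥ 2` … [fixed closed edges, total
estrangement] … `H` is contained in some edge-like subgroup, hence also in two distinct verticial
subgroups … (c) Now it follows formally from (a), (b) that `H` is always contained in some
verticial subgroup".

This proof-only file assembles case (a) and the formal step (c) for an arbitrary chart
`c : TemperedPiChart 𝒢`, at the level of the TREES `T_j = 𝒢_{j,∞}` (the order of record after the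
errata pass ε2), modulo the level data of the chart (rung 1, abc-iut-L3-t9): trees `T_j` over `𝔾`
with vertices, actions `ρ_j : π₁^temp(𝒢) → Aut T_j` over `𝔾` with open kernels, equivariant
transition morphisms `f : T_j ⟶ T_i` (`i ≤ j`), and the tree-level IDENTIFICATION `hstab`: the
pointwise stabiliser of a compatible system of vertices of the `T_j` lies in a verticial subgroup
(shape (I2) shared with the second part, abc-iut-L3-t11).  Case (b) is the second part's
machinery (fixed closed edges, total estrangement) and enters (c) as a named input.

* `compactInVerticial_conj1_caseA` — (a): if at every level the set of `C`-fixed vertices of `T_j`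
  has at most one element, then (it has exactly one, by Lemma 1.8 (ii)(a) over `𝔾`, and) the fixed
  vertices form a compatible system, so `C` lies in a verticial subgroup;
* `cofinal_dichotomy` — (c)'s formal step: in a directed index set, for any property of levels
  either the levels having it or the levels failing it form a cofinal subset.
-/

namespace Literature.AnabelianGeometry.SemiGraphs

namespace ProfiniteSemiGraph

open CategoryTheory Topology

universe u v

variable {𝒢 : ProfiniteSemiGraph.{u}}

/-- **Thm. 3.7 (iii), first part, case (a)** (Comments (6)(a)), at tree level and modulo the level
data of the chart: if for every level `j` the `C`-fixed vertices of the tree `T_j` form a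
subsingleton, they form a compatible system (each is nonempty by Lemma 1.8 (ii)(a), the action
being over `𝔾` through a finite quotient), and the identification `hstab` puts `C` inside a
verticial subgroup.  The index set is the cofinal subset of case (a), re-indexed by the caller.
[cite: MochizukiSemiAnbd2006, Thm. 3.7(iii) p.41] -/
theorem compactInVerticial_conj1_caseA (c : TemperedPiChart 𝒢) {J : Type v} [Preorder J]
    (T : J → SemiGraph.{u}) (hT : ∀ j, (T j).IsTree) (v₀ : ∀ j, (T j).Vertex)
    (p : ∀ j, T j ⟶ 𝒢.graph) (ρ : ∀ j, c.G →* Aut (T j))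
    (hker : ∀ j, IsOpen ((ρ j).ker : Set c.G))
    (hover : ∀ (j : J) (g : c.G), (ρ j g).hom ≫ p j = p j)
    (f : ∀ ⦃i j : J⦄, i ≤ j → (T j ⟶ T i))
    (hequiv : ∀ ⦃i j : J⦄ (h : i ≤ j) (g : c.G) (x : (T j).Vertex),
      (f h).vertexMap ((ρ j g).hom.vertexMap x) = (ρ i g).hom.vertexMap ((f h).vertexMap x))
    (hstab : ∀ x : (∀ j, (T j).Vertex), (∀ ⦃i j : J⦄ (h : i ≤ j), (f h).vertexMap (x j) = x i) →
      ∃ (v : 𝒢.graph.Vertex) (H : Subgroup c.G), H ∈ verticialSubgroups c v ∧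
        ∀ g : c.G, (∀ j, (ρ j g).hom.vertexMap (x j) = x j) → g ∈ H)
    (C : Subgroup c.G) (hC : IsCompact (C : Set c.G))
    (hone : ∀ j, {x : (T j).Vertex | ∀ g : C, (ρ j g).hom.vertexMap x = x}.Subsingleton) :
    ∃ (v : 𝒢.graph.Vertex) (H : Subgroup c.G), H ∈ verticialSubgroups c v ∧ C ≤ H := by
  -- at each level, a `C`-fixed vertex (Lemma 1.8 (ii)(a), no branch switching over `𝔾`)
  have hex : ∀ j, ∃ x : (T j).Vertex, ∀ g : C, (ρ j g).hom.vertexMap x = x := fun j =>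
    SemiGraph.exists_fixed_vertex_of_isCompact_over C hC (hT j) (v₀ j) (p j) (ρ j) (hker j) (hover j)
  choose x hx using hex
  -- uniqueness makes the system compatible
  have hcompat : ∀ ⦃i j : J⦄ (h : i ≤ j), (f h).vertexMap (x j) = x i := by
    intro i j h
    apply hone i
    · intro g
      have e := hequiv h g (x j)
      rw [hx j g] at e
      exact e.symm
    · exact hx i
  obtain ⟨v, H, hH, hmem⟩ := hstab x hcompat
  exact ⟨v, H, hH, fun g hg => hmem g fun j => hx j ⟨g, hg⟩⟩

/-- **The formal step (c)** (Comments (6)(c): "it follows formally from (a), (b)"): in a directed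
index set, for every property `P` of the levels, either the levels satisfying `P` or the levels
failing `P` form a COFINAL subset.  (Applied with `P j :=` "`T_j` has at most one `C`-fixed
vertex": cofinally (a), or cofinally (b).) [cite: MochizukiSemiAnbd2006, Thm. 3.7(iii) p.41] -/
theorem cofinal_dichotomy {J : Type v} [Preorder J] [IsDirectedOrder J] (P : J → Prop) :
    (∀ j, ∃ s, P s ∧ j ≤ s) ∨ (∀ j, ∃ s, ¬ P s ∧ j ≤ s) := by
  by_cases h : ∀ j, ∃ s, P s ∧ j ≤ s
  · exact Or.inl h
  · right
    push Not at h
    obtain ⟨j₀, hj₀⟩ := h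
    intro j
    obtain ⟨k, hjk, hj₀k⟩ := exists_ge_ge j j₀
    exact ⟨k, fun hk => hj₀ k hk hj₀k, hjk⟩

/-- **Thm. 3.7 (iii), first part, assembled from (a), (b), (c)** modulo the level data and the two
named inputs of the other cases: `caseB` — the conclusion in case (b) (cofinally at least two
`C`-fixed vertices; supplied by the second part's fixed-closed-edge argument: `C` lies in an
edge-like subgroup, hence in a verticial one) — for the data RESTRICTED to any cofinal subset, and
`caseA` likewise (this file's `compactInVerticial_conj1_caseA` applied to the restricted data).
[cite: MochizukiSemiAnbd2006, Thm. 3.7(iii) p.41] -/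
theorem compactInVerticial_conj1_of_cases (c : TemperedPiChart 𝒢) {J : Type v} [Preorder J]
    [IsDirectedOrder J] (P : J → Prop) (C : Subgroup c.G)
    (caseA : (∀ j, ∃ s, P s ∧ j ≤ s) →
      ∃ (v : 𝒢.graph.Vertex) (H : Subgroup c.G), H ∈ verticialSubgroups c v ∧ C ≤ H)
    (caseB : (∀ j, ∃ s, ¬ P s ∧ j ≤ s) →
      ∃ (v : 𝒢.graph.Vertex) (H : Subgroup c.G), H ∈ verticialSubgroups c v ∧ C ≤ H) :
    ∃ (v : 𝒢.graph.Vertex) (H : Subgroup c.G), H ∈ verticialSubgroups c v ∧ C ≤ H := by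
  rcases cofinal_dichotomy P with h | h
  · exact caseA h
  · exact caseB h

end ProfiniteSemiGraph

end Literature.AnabelianGeometry.SemiGraphs
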